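import Literature.Computability.QuantumComplexity.ForrelationThm25Amplitude
import Literature.Computability.QuantumComplexity.ShallowCircuitsProofs
import HarnessLib

/-!
# Embedded states, Hadamard layers and the hop layer of the Hadamard gadget

Topic `Literature/Computability/QuantumComplexity`; first file of the discharge of the named fact
`PostBQPWith_subset_PostIQPWith` (`PostBQPToPostIQP.lean`: M. J. Bremner, R. Jozsa, D. J. Shepherd,
*Classical simulation of commuting quantum computations implies collapse of the polynomial
hierarchy*, Proc. R. Soc. A 467 (2011) 459–472 = arXiv:1005.1407, Thm. 1 and its proof, p. 7:
the **Hadamard gadget**). The printed gadget: on lines `a, e` in the state `|ψ⟩_a |0⟩_e` apply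
`H_a CZ_{ae} H_e` and post-select the outcome `0` on line `a`; "an easy calculation shows that the
resulting state on line `e` is `H|ψ⟩`" (p. 7). In an IQP circuit `H^{⊗W} D H^{⊗W}` the gate `H_e`
is the initial Hadamard of the fresh line `e`, `H_a` is the final Hadamard of line `a`, and only the
diagonal `CZ_{ae}` sits in `D`.

This file is the state-vector calculus in which the compiled circuit of the sequel files is
analysed (register of `W` wires, `N` logical qubits sitting on the wires of an embedding
`pos : Fin N ↪ Fin W`):

* `HGadget.ZeroOn S z` (all wires of the finite set `S` read `0`), the projector `HGadget.zeroProj S`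
  (a diagonal `0/1` matrix) and its algebra (`zeroProj_union`, commutation with diagonals and with
  Hadamard layers on other wires);
* the Hadamard layer `BGK.hLayerMatrix S` of `ShallowCircuitsProofs.lean` on a finite set of wires:
  `hLayerMatrix_univ` (`= H^{⊗W}`), `hLayerMatrix_union` (layers on disjoint sets multiply),
  `hLayerMatrix_mul_diagonal_comm` (a layer commutes with a diagonal operator whose phase ignores its
  wires), `hLayerMatrix_map_mulVec_apply` (action of the layer on the wires of an embedding);
* `HGadget.embedState pos S φ`: the logical state `φ` of `N` qubits placed on the wires `pos`, the
  spent wires `S` reading `0`, every other wire in the *unnormalised* uniform superposition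
  `|0⟩ + |1⟩` — and its calculus: projection (`zeroProj_mulVec_embedState`), diagonal gates on the
  logical wires (`diagonal_mulVec_embedState`), a Hadamard layer on the logical wires
  (`hLayerMatrix_map_mulVec_embedState`), a Hadamard layer on fresh wires
  (`hLayerMatrix_fresh_mulVec_embedState`: each fresh wire collapses to `|0⟩` with weight `√2`),
  the initial state `H^{⊗W}|x 0…0⟩` (`hGateAll_mulVec_basisState_eq_embedState`);
* **the hop layer** (`HGadget.hopLayer_embedState`): with `CZ` between `pos j` and a fresh wire
  `tgt j` for every logical qubit `j`, the final Hadamards on the wires `pos` and the post-selection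
  of `0…0` there move the logical state to the wires `tgt` *and apply `H^{⊗N}` to it* — the
  `N`-fold form of BJS's "easy calculation";
* the read-out of squared amplitudes of an embedded state over the logical register
  (`sum_ite_normSq_embedState`).

## References

* M. J. Bremner, R. Jozsa, D. J. Shepherd, Proc. R. Soc. A 467 (2011) 459–472, arXiv:1005.1407,
  proof of Thm. 1 (p. 7, Fig. 1: the Hadamard gadget).
* M. A. Nielsen, I. L. Chuang, *Quantum Computation and Quantum Information*, CUP 2010, §1.4.4
  eq. (1.50) (`H^{⊗n}`), §4.2 (placement of gates), §2.2.5 (Born rule).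
-/

noncomputable section

namespace Literature.Computability.QuantumComplexity

open Matrix Cryptography Finset

namespace HGadget

variable {W N k : ℕ}

/-! ### Hadamard entries -/

/-- The two spellings of `⟨a|H|b⟩` in the tree agree (`BGK.hCoef` of `ShallowCircuitsProofs.lean`,
`hadamardEntry` of `ForrelationThm25Amplitude.lean`). [cite: NielsenChuang2010, §1.3.1] -/
theorem hCoef_eq_hadamardEntry (a b : Bool) : BGK.hCoef a b = hadamardEntry a b := by
  cases a <;> cases b <;> simp [BGK.hCoef, hadamardEntry, invSqrt2]

/-- `⟨a|H|b⟩ = (-1)^{ab}/√2` with the sign written as an `if`. [cite: NielsenChuang2010, §1.3.1] -/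
theorem hadamardEntry_eq (a b : Bool) :
    hadamardEntry a b = (Real.sqrt 2 : ℂ)⁻¹ * (if (a && b) = true then -1 else 1) := rfl

/-- `⟨0|H|b⟩ = 1/√2`. [cite: NielsenChuang2010, §1.3.1] -/
theorem hadamardEntry_false_left (b : Bool) : hadamardEntry false b = (Real.sqrt 2 : ℂ)⁻¹ := by
  simp [hadamardEntry]

/-- `⟨a|H|0⟩ = 1/√2`. [cite: NielsenChuang2010, §1.3.1] -/
theorem hadamardEntry_false_right (a : Bool) : hadamardEntry a false = (Real.sqrt 2 : ℂ)⁻¹ := by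
  cases a <;> simp [hadamardEntry]

/-- `∑_b ⟨a|H|b⟩ = √2 · [a = 0]` (the column sums of `H`). [cite: NielsenChuang2010, §1.3.1] -/
theorem sum_hadamardEntry (a : Bool) :
    ∑ b, hadamardEntry a b = if a = false then (Real.sqrt 2 : ℂ) else 0 := by
  rw [Fintype.sum_bool]
  have h2 : (Real.sqrt 2 : ℂ)⁻¹ + (Real.sqrt 2 : ℂ)⁻¹ = Real.sqrt 2 := by
    rw [← two_mul, ← div_eq_mul_inv]
    have hs : (Real.sqrt 2 : ℂ) ≠ 0 := by
      exact_mod_cast (Real.sqrt_pos.2 (by norm_num : (0:ℝ) < 2)).ne'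
    rw [div_eq_iff hs, ← Complex.ofReal_mul, Real.mul_self_sqrt (by norm_num : (0:ℝ) ≤ 2)]
    norm_num
  cases a <;> simp [hadamardEntry, h2]

/-! ### All-zero tests and the projector onto them -/

/-- `ZeroOn S z`: every wire of `S` reads `0` in the basis label `z` (the post-selection event
`P = 0…0` of BJS on the register `S`). [cite: BremnerJozsaShepherdPRSA2011, §2.4] -/
def ZeroOn (S : Finset (Fin W)) (z : QReg W) : Prop := ∀ w ∈ S, z w = false

/-- `ZeroOn S` is decidable (a finite conjunction of Boolean tests). [folklore] -/
instance (S : Finset (Fin W)) : DecidablePred (ZeroOn S) := fun z => by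
  unfold ZeroOn; infer_instance

/-- `ZeroOn` of a union. [folklore] -/
theorem zeroOn_union {S T : Finset (Fin W)} {z : QReg W} : ZeroOn (S ∪ T) z ↔ ZeroOn S z ∧ ZeroOn T z := by
  simp only [ZeroOn, Finset.mem_union, or_imp, forall_and]

/-- `ZeroOn ∅` always holds. [folklore] -/
theorem zeroOn_empty (z : QReg W) : ZeroOn (∅ : Finset (Fin W)) z := fun w hw => absurd hw (by simp)

/-- `ZeroOn` only looks at the wires of `S`. [folklore] -/
theorem zeroOn_congr {S : Finset (Fin W)} {z z' : QReg W} (h : ∀ w ∈ S, z w = z' w) :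
    ZeroOn S z ↔ ZeroOn S z' := by
  constructor
  · intro hz w hw; rw [← h w hw]; exact hz w hw
  · intro hz w hw; rw [h w hw]; exact hz w hw

/-- The projector onto "all wires of `S` read `0`": the diagonal `0/1` matrix of the event.
(BJS 2011, §2.4: post-selection on `P = 0…0`.) [cite: BremnerJozsaShepherdPRSA2011, §2.4] -/
def zeroProj (S : Finset (Fin W)) : Matrix (QReg W) (QReg W) ℂ :=
  Matrix.diagonal fun z => if ZeroOn S z then 1 else 0

/-- Action of the projector on a vector. [folklore] -/
theorem zeroProj_mulVec_apply (S : Finset (Fin W)) (v : QReg W → ℂ) (z : QReg W) :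
    (zeroProj S *ᵥ v) z = if ZeroOn S z then v z else 0 := by
  rw [zeroProj, mulVec_diagonal]
  split_ifs <;> simp

/-- Projecting on two registers is projecting on their union. [folklore] -/
theorem zeroProj_union (S T : Finset (Fin W)) : zeroProj (S ∪ T) = zeroProj S * zeroProj T := by
  rw [zeroProj, zeroProj, zeroProj, diagonal_mul_diagonal]
  congr 1
  funext z
  by_cases hS : ZeroOn S z <;> by_cases hT : ZeroOn T z <;>
    simp [zeroOn_union, hS, hT]

/-- The projector commutes with every diagonal operator. [folklore] -/
theorem zeroProj_mul_diagonal_comm (S : Finset (Fin W)) (d : QReg W → ℂ) :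
    zeroProj S * diagonal d = diagonal d * zeroProj S := by
  rw [zeroProj, diagonal_mul_diagonal, diagonal_mul_diagonal]
  congr 1
  funext z
  exact mul_comm _ _

/-! ### Hadamard layers on finite sets of wires -/

open BGK (hLayerMatrix hLayerMatrix_apply hLayerMatrix_empty)

/-- The Hadamard layer on all wires is `H^{⊗W}`. [cite: NielsenChuang2010, §1.4.4 eq. (1.50)] -/
theorem hLayerMatrix_univ : hLayerMatrix (Finset.univ : Finset (Fin W)) = hGateAll W := by
  ext x y
  rw [hLayerMatrix_apply, if_pos (fun i hi => absurd (Finset.mem_univ i) hi), hGateAll_apply_eq_prod]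
  exact Finset.prod_congr rfl fun i _ => hCoef_eq_hadamardEntry _ _

/-- **Hadamard layers on disjoint sets of wires multiply to the layer on the union**
(`H^{⊗(S ∪ T)} = H^{⊗S} H^{⊗T}`). [cite: NielsenChuang2010, §4.2] -/
theorem hLayerMatrix_union {S T : Finset (Fin W)} (hST : Disjoint S T) :
    hLayerMatrix (S ∪ T) = hLayerMatrix S * hLayerMatrix T := by
  ext x z
  rw [Matrix.mul_apply, hLayerMatrix_apply]
  -- the unique contributing intermediate label: `z` on `S`, `x` elsewhere
  set y₀ : QReg W := fun i => if i ∈ S then z i else x i with hy₀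
  have hy₀S : ∀ i ∈ S, y₀ i = z i := fun i hi => by simp [hy₀, hi]
  have hy₀off : ∀ i, i ∉ S → y₀ i = x i := fun i hi => by simp [hy₀, hi]
  have hdisj : ∀ i ∈ S, i ∉ T := fun i hi hiT => Finset.disjoint_left.1 hST hi hiT
  rw [Finset.sum_eq_single y₀]
  · rw [hLayerMatrix_apply, hLayerMatrix_apply, if_pos fun i hi => (hy₀off i hi).symm]
    by_cases hc : ∀ i, i ∉ S ∪ T → x i = z i
    · rw [if_pos hc, if_pos, Finset.prod_union hST]
      · congr 1
        · exact Finset.prod_congr rfl fun i hi => by rw [hy₀S i hi]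
        · exact Finset.prod_congr rfl fun i hi => by rw [hy₀off i (fun hiS => hdisj i hiS hi)]
      · intro i hiT
        by_cases hiS : i ∈ S
        · exact hy₀S i hiS
        · rw [hy₀off i hiS]; exact hc i (by simp [hiS, hiT])
    · rw [if_neg hc]
      by_cases h2 : ∀ i, i ∉ T → y₀ i = z i
      · exfalso; apply hc; intro i hi
        rw [Finset.mem_union, not_or] at hi
        rw [← hy₀off i hi.1]; exact h2 i hi.2
      · rw [if_neg h2, mul_zero]
  · intro y _ hy
    rw [hLayerMatrix_apply, hLayerMatrix_apply]
    by_cases h1 : ∀ i, i ∉ S → x i = y i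
    · by_cases h2 : ∀ i, i ∉ T → y i = z i
      · exfalso; apply hy; funext i
        by_cases hiS : i ∈ S
        · rw [hy₀S i hiS]; exact h2 i (hdisj i hiS)
        · rw [hy₀off i hiS]; exact (h1 i hiS).symm
      · rw [if_neg h2, mul_zero]
    · rw [if_neg h1, zero_mul]
  · intro h; exact absurd (Finset.mem_univ _) h

/-- The Hadamard layer on a single wire is the placed Hadamard gate. [cite: NielsenChuang2010, §4.2] -/
theorem hLayerMatrix_singleton (w : Fin W) : hLayerMatrix ({w} : Finset (Fin W)) = placeGate (wireEmb w) hGate := by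
  rw [← one_mul (placeGate (wireEmb w) hGate), ← hLayerMatrix_empty,
    BGK.hLayerMatrix_mul_placeGate_hGate ∅ w (by simp)]
  rfl

/-- **A Hadamard layer commutes with a diagonal operator whose phase ignores its wires.**
[cite: NielsenChuang2010, §4.2] -/
theorem hLayerMatrix_mul_diagonal_comm (S : Finset (Fin W)) {d : QReg W → ℂ}
    (hd : ∀ x y : QReg W, (∀ i, i ∉ S → x i = y i) → d x = d y) :
    hLayerMatrix S * diagonal d = diagonal d * hLayerMatrix S := by
  ext x y
  rw [Matrix.mul_diagonal, Matrix.diagonal_mul, hLayerMatrix_apply]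
  split_ifs with h
  · rw [hd x y h, mul_comm]
  · rw [zero_mul, mul_zero]

/-- The projector onto `0…0` on `S` commutes with a Hadamard layer on wires disjoint from `S`.
[folklore] -/
theorem zeroProj_mul_hLayerMatrix_comm {S T : Finset (Fin W)} (hST : Disjoint S T) :
    zeroProj S * hLayerMatrix T = hLayerMatrix T * zeroProj S := by
  rw [zeroProj, ← hLayerMatrix_mul_diagonal_comm]
  intro x y hxy
  have : ZeroOn S x ↔ ZeroOn S y :=
    zeroOn_congr fun w hw => hxy w fun hwT => Finset.disjoint_left.1 hST hw hwT
  simp [this]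

/-- Membership in the image of an embedding, as a range condition. [folklore] -/
theorem not_mem_map_univ_iff (e : Fin k ↪ Fin W) (i : Fin W) :
    i ∉ Finset.univ.map e ↔ i ∉ Set.range e := by
  simp

/-- **Action of the Hadamard layer on the wires of an embedding `e`**:
`(H_e v)(z) = ∑_{u ∈ {0,1}^k} (∏ⱼ ⟨z_{e j}|H|u_j⟩) · v(z with e ↦ u)`.
[cite: NielsenChuang2010, §1.4.4 eq. (1.50) and §4.2] -/
theorem hLayerMatrix_map_mulVec_apply (e : Fin k ↪ Fin W) (v : QReg W → ℂ) (z : QReg W) :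
    (hLayerMatrix (Finset.univ.map e) *ᵥ v) z =
      ∑ u : QReg k, (∏ j, hadamardEntry (z (e j)) (u j)) * v (Function.extend e u z) := by
  rw [Matrix.mulVec, dotProduct]
  have h : ∀ w : QReg W, hLayerMatrix (Finset.univ.map e) z w * v w =
      if (∀ i, i ∉ Set.range e → w i = z i) then (∏ j, hadamardEntry (z (e j)) (w (e j))) * v w else 0 := by
    intro w
    rw [hLayerMatrix_apply]
    by_cases hw : ∀ i, i ∉ Set.range e → w i = z i
    · rw [if_pos hw, if_pos fun i hi => (hw i ((not_mem_map_univ_iff e i).1 hi)).symm, Finset.prod_map]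
      simp only [hCoef_eq_hadamardEntry]
    · rw [if_neg hw, if_neg fun h' => hw fun i hi => (h' i ((not_mem_map_univ_iff e i).2 hi)).symm, zero_mul]
  simp_rw [h]
  rw [sum_ite_agree_eq_sum_extend]
  refine Finset.sum_congr rfl fun u _ => ?_
  simp only [e.injective.extend_apply]

/-! ### Embedded logical states -/

/-- **Embedded state.** The logical state `φ` of `N` qubits sitting on the wires `pos`, the spent
wires `S` reading `0`, and every other wire in the *unnormalised* superposition `|0⟩ + |1⟩`:
`z ↦ [z|_S = 0] · φ(z ∘ pos)`. This is the shape of the state of the compiled IQP circuit after the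
final Hadamards and the post-selections of the wires hopped so far (the invariant of the gadget
induction); the weights `1/√2` of the fresh wires are kept in `φ`.
[cite: BremnerJozsaShepherdPRSA2011, Thm. 1 (proof)] -/
def embedState (pos : Fin N ↪ Fin W) (S : Finset (Fin W)) (φ : QReg N → ℂ) : QReg W → ℂ :=
  fun z => if ZeroOn S z then φ (z ∘ pos) else 0

/-- Amplitudes of an embedded state (definitional). [folklore] -/
theorem embedState_apply (pos : Fin N ↪ Fin W) (S : Finset (Fin W)) (φ : QReg N → ℂ) (z : QReg W) :
    embedState pos S φ z = if ZeroOn S z then φ (z ∘ pos) else 0 := rfl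

/-- Embedding is linear: scalars pass through. [folklore] -/
theorem embedState_smul (pos : Fin N ↪ Fin W) (S : Finset (Fin W)) (c : ℂ) (φ : QReg N → ℂ) :
    embedState pos S (c • φ) = c • embedState pos S φ := by
  funext z
  simp only [embedState_apply, Pi.smul_apply, smul_eq_mul]
  split_ifs <;> simp

/-- **Projection.** Post-selecting `0…0` on further wires `T` of an embedded state enlarges the
spent set: `P_T (embed pos S φ) = embed pos (S ∪ T) φ`. [cite: BremnerJozsaShepherdPRSA2011, §2.4] -/
theorem zeroProj_mulVec_embedState (T : Finset (Fin W)) (pos : Fin N ↪ Fin W) (S : Finset (Fin W))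
    (φ : QReg N → ℂ) : zeroProj T *ᵥ embedState pos S φ = embedState pos (S ∪ T) φ := by
  funext z
  rw [zeroProj_mulVec_apply, embedState_apply, embedState_apply]
  by_cases hT : ZeroOn T z <;> by_cases hS : ZeroOn S z <;> simp [zeroOn_union, hS, hT]

/-- Overwriting the logical wires does not change the spent wires (which are disjoint from them).
[folklore] -/
theorem zeroOn_extend_iff {pos : Fin N ↪ Fin W} {S : Finset (Fin W)} (hS : ∀ j, pos j ∉ S)
    (u : QReg N) (z : QReg W) : ZeroOn S (Function.extend pos u z) ↔ ZeroOn S z :=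
  zeroOn_congr fun w hw => extend_apply_of_not_mem pos u z (by rintro ⟨j, rfl⟩; exact hS j hw)

/-- **Diagonal gates on the logical wires.** A diagonal operator whose phase, on the event
`z|_S = 0`, is a function `d'` of the logical register acts on the logical state:
`diag(d) (embed pos S φ) = embed pos S (d' · φ)`. (The `Z`, `CZ`, `T` gates of the compiled circuit.)
[cite: BremnerJozsaShepherdPRSA2011, Thm. 1 (proof)] -/
theorem diagonal_mulVec_embedState {d : QReg W → ℂ} {d' : QReg N → ℂ} (pos : Fin N ↪ Fin W)
    (S : Finset (Fin W)) (hd : ∀ z, ZeroOn S z → d z = d' (z ∘ pos)) (φ : QReg N → ℂ) :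
    diagonal d *ᵥ embedState pos S φ = embedState pos S (fun y => d' y * φ y) := by
  funext z
  rw [mulVec_diagonal, embedState_apply, embedState_apply]
  split_ifs with h
  · rw [hd z h]
  · rw [mul_zero]

/-- **A Hadamard layer on the logical wires** acts as `H^{⊗N}` on the logical state.
[cite: NielsenChuang2010, §1.4.4 eq. (1.50)] -/
theorem hLayerMatrix_map_mulVec_embedState (pos : Fin N ↪ Fin W) {S : Finset (Fin W)}
    (hS : ∀ j, pos j ∉ S) (φ : QReg N → ℂ) :
    hLayerMatrix (Finset.univ.map pos) *ᵥ embedState pos S φ = embedState pos S (hGateAll N *ᵥ φ) := by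
  funext z
  rw [hLayerMatrix_map_mulVec_apply, embedState_apply]
  simp only [embedState_apply, zeroOn_extend_iff hS, extend_comp_embedding]
  split_ifs with h
  · rw [Matrix.mulVec, dotProduct]
    refine Finset.sum_congr rfl fun u _ => ?_
    rw [hGateAll_apply_eq_prod]
    rfl
  · simp

/-- A Hadamard gate on ONE fresh wire of an embedded state collapses it to `|0⟩` with weight `√2`
(`H(|0⟩ + |1⟩) = √2 |0⟩`). [cite: NielsenChuang2010, §1.3.1] -/
theorem hLayerMatrix_singleton_mulVec_embedState (pos : Fin N ↪ Fin W) {S : Finset (Fin W)} {w : Fin W}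
    (hwS : w ∉ S) (hwpos : w ∉ Set.range pos) (φ : QReg N → ℂ) :
    hLayerMatrix ({w} : Finset (Fin W)) *ᵥ embedState pos S φ =
      embedState pos (insert w S) ((Real.sqrt 2 : ℂ) • φ) := by
  have hmap : ({w} : Finset (Fin W)) = Finset.univ.map (wireEmb w) := by
    ext i; simp
  funext z
  rw [hmap, hLayerMatrix_map_mulVec_apply, embedState_apply]
  -- the overwritten register agrees with `z` on `S` and on the logical wires
  have hval : ∀ u : QReg 1, embedState pos S φ (Function.extend (wireEmb w) u z) = embedState pos S φ z := by
    intro u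
    rw [embedState_apply, embedState_apply]
    have hoff : ∀ i, i ≠ w → Function.extend (wireEmb w) u z i = z i := fun i hi =>
      extend_apply_of_not_mem (wireEmb w) u z (by simpa using hi)
    have h1 : ZeroOn S (Function.extend (wireEmb w) u z) ↔ ZeroOn S z :=
      zeroOn_congr fun i hi => hoff i (fun h => hwS (h ▸ hi))
    have h2 : Function.extend (wireEmb w) u z ∘ pos = z ∘ pos :=
      funext fun j => hoff (pos j) (fun h => hwpos ⟨j, h⟩)
    rw [h2]; simp only [h1]
  simp_rw [hval, Fin.prod_univ_one, wireEmb_apply, ← Finset.sum_mul]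
  rw [show (∑ u : QReg 1, hadamardEntry (z w) (u 0)) = ∑ b : Bool, hadamardEntry (z w) b from
    (Fintype.sum_equiv (Equiv.funUnique (Fin 1) Bool) _ _ fun u => rfl), sum_hadamardEntry]
  simp only [Pi.smul_apply, smul_eq_mul, ZeroOn, Finset.mem_insert, forall_eq_or_imp]
  by_cases hzw : z w = false <;> by_cases hS' : ∀ a ∈ S, z a = false <;> simp [hzw, hS', embedState_apply, ZeroOn]

/-- **A Hadamard layer on fresh wires** `R` (disjoint from the spent and the logical wires)
collapses each of them to `|0⟩`: `H_R (embed pos S φ) = embed pos (S ∪ R) ((√2)^{|R|} φ)`.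
[cite: NielsenChuang2010, §1.3.1] -/
theorem hLayerMatrix_fresh_mulVec_embedState (pos : Fin N ↪ Fin W) {S : Finset (Fin W)} (R : Finset (Fin W))
    (hRS : Disjoint R S) (hRpos : ∀ j, pos j ∉ R) (φ : QReg N → ℂ) :
    hLayerMatrix R *ᵥ embedState pos S φ = embedState pos (S ∪ R) (((Real.sqrt 2 : ℂ) ^ R.card) • φ) := by
  induction R using Finset.induction_on generalizing S with
  | empty => simp [hLayerMatrix_empty]
  | @insert w R hwR ih =>
    have hwS : w ∉ S := fun h => Finset.disjoint_left.1 hRS (Finset.mem_insert_self w R) h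
    have hRS' : Disjoint R S := Finset.disjoint_of_subset_left (Finset.subset_insert w R) hRS
    have hRpos' : ∀ j, pos j ∉ R := fun j h => hRpos j (Finset.mem_insert_of_mem h)
    have hwpos : w ∉ Set.range pos := by rintro ⟨j, rfl⟩; exact hRpos j (Finset.mem_insert_self _ R)
    have hunion : hLayerMatrix (insert w R) = hLayerMatrix ({w} : Finset (Fin W)) * hLayerMatrix R := by
      rw [Finset.insert_eq, hLayerMatrix_union (Finset.disjoint_singleton_left.2 hwR)]
    rw [hunion, ← mulVec_mulVec, ih hRS' hRpos',
      hLayerMatrix_singleton_mulVec_embedState pos (by simp [hwS, hwR]) hwpos,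
      smul_smul, Finset.card_insert_of_notMem hwR, pow_succ, mul_comm]
    congr 1
    ext i; simp

/-! ### The hop layer -/

/-- The phase of the layer of `CZ` gates joining each logical wire `pos j` to its target wire
`tgt j`: `∏ⱼ (-1)^{z_{pos j} z_{tgt j}}`. [cite: BremnerJozsaShepherdPRSA2011, Thm. 1 (proof, Fig. 1: the `CZ_{ae}` of the gadget)] -/
def czLayerPhase (pos tgt : Fin N ↪ Fin W) : QReg W → ℂ :=
  fun z => ∏ j, (if (z (pos j) && z (tgt j)) = true then (-1 : ℂ) else 1)

/-- The phase of the `CZ` layer (definitional). [folklore] -/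
theorem czLayerPhase_apply (pos tgt : Fin N ↪ Fin W) (z : QReg W) :
    czLayerPhase pos tgt z = ∏ j, (if (z (pos j) && z (tgt j)) = true then (-1 : ℂ) else 1) := rfl

/-- The `CZ`-layer phase only depends on the wires `pos j`, `tgt j`. [folklore] -/
theorem czLayerPhase_congr (pos tgt : Fin N ↪ Fin W) {x y : QReg W}
    (h : ∀ j, x (pos j) = y (pos j) ∧ x (tgt j) = y (tgt j)) : czLayerPhase pos tgt x = czLayerPhase pos tgt y := by
  simp only [czLayerPhase_apply]
  exact Finset.prod_congr rfl fun j _ => by rw [(h j).1, (h j).2]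

/-- **The hop layer (BJS's Hadamard gadget, all logical qubits at once).** Let the logical state
`φ` sit on the wires `pos`, with spent wires `S`, and let `tgt` be fresh wires (off `pos`; the
targets `e` of the gadgets, each in `|0⟩ + |1⟩` after its initial Hadamard). Apply the `CZ` layer
`∏ⱼ CZ_{pos j, tgt j}`, then the (final) Hadamards on the wires `pos`, and post-select `0…0` on
`pos`: the result is the logical state `H^{⊗N} φ` on the wires `tgt`, with `pos` added to the spent
wires — "the resulting state on line `e` is `H|ψ⟩`" for every line, exactly (the weights `1/√2`
of the gadgets are the normalisation of `H^{⊗N}`, the fresh wires being unnormalised here).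
[cite: BremnerJozsaShepherdPRSA2011, Thm. 1 (proof, p. 7, Fig. 1)] -/
theorem hopLayer_embedState (pos tgt : Fin N ↪ Fin W) {S : Finset (Fin W)} (hS : ∀ j, pos j ∉ S)
    (hT : ∀ j, tgt j ∉ Set.range pos) (φ : QReg N → ℂ) :
    zeroProj (Finset.univ.map pos) *ᵥ (hLayerMatrix (Finset.univ.map pos) *ᵥ
        (diagonal (czLayerPhase pos tgt) *ᵥ embedState pos S φ)) =
      embedState tgt (S ∪ Finset.univ.map pos) (hGateAll N *ᵥ φ) := by
  funext z
  rw [zeroProj_mulVec_apply, embedState_apply]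
  by_cases hz : ZeroOn (Finset.univ.map pos) z
  · rw [if_pos hz, hLayerMatrix_map_mulVec_apply]
    have hzj : ∀ j, z (pos j) = false := fun j => hz _ (Finset.mem_map_of_mem _ (Finset.mem_univ j))
    simp only [hzj, hadamardEntry_false_left, Finset.prod_const, Finset.card_univ, Fintype.card_fin,
      mulVec_diagonal, embedState_apply, zeroOn_extend_iff hS, extend_comp_embedding]
    by_cases hSz : ZeroOn S z
    · rw [if_pos (zeroOn_union.2 ⟨hSz, hz⟩)]
      simp only [if_pos hSz]
      rw [Matrix.mulVec, dotProduct]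
      refine Finset.sum_congr rfl fun u _ => ?_
      have h1 : ∀ j, Function.extend pos u z (pos j) = u j := fun j => pos.injective.extend_apply _ _ j
      have h2 : ∀ j, Function.extend pos u z (tgt j) = z (tgt j) := fun j =>
        extend_apply_of_not_mem pos u z (hT j)
      rw [hGateAll_apply_eq_prod, czLayerPhase_apply]
      simp only [h1, h2, hadamardEntry_eq, Finset.prod_mul_distrib, Finset.prod_const, Finset.card_univ,
        Fintype.card_fin, Function.comp_apply]
      have hcomm : ∀ j, (u j && z (tgt j)) = (z (tgt j) && u j) := fun j => Bool.and_comm _ _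
      simp only [hcomm]
      ring
    · rw [if_neg (fun h => hSz (zeroOn_union.1 h).1)]
      simp [hSz]
  · rw [if_neg hz, if_neg (fun h => hz (zeroOn_union.1 h).2)]

/-! ### The initial state -/

/-- A wire enumerated by the complementary embedding is not a logical wire. [folklore] -/
theorem complWireEmb_not_mem_range (e : Fin k ↪ Fin W) (l : Fin ((Finset.univ.map e)ᶜ.card)) :
    complWireEmb e l ∉ Set.range e := fun h =>
  Set.disjoint_left.1 (disjoint_range_complWireEmb e) h ⟨l, rfl⟩

/-- **The initial state of an IQP circuit is an embedded state.** After the initial Hadamards,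
`H^{⊗W} |x'⟩` — where the input `x'` vanishes off the home wires `home` of the logical qubits — is
the logical state `(1/√2)^{W-N} H^{⊗N} |x' ∘ home⟩` on the home wires, no wire spent, all other
wires in `|0⟩ + |1⟩`. [cite: BremnerJozsaShepherdPRSA2011, §2.3 (IQP circuits in the `Z`-basis form: every line begins with `H`)] -/
theorem hGateAll_mulVec_basisState_eq_embedState (home : Fin N ↪ Fin W) (x' : QReg W)
    (hx : ∀ w, w ∉ Set.range home → x' w = false) :
    hGateAll W *ᵥ basisState x' =
      embedState home ∅ ((((Real.sqrt 2 : ℂ)⁻¹) ^ (W - N)) • (hGateAll N *ᵥ basisState (x' ∘ home))) := by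
  funext z
  have lhs : (hGateAll W *ᵥ basisState x') z = hGateAll W z x' := by rw [mulVec_basisState]
  have rhs : (hGateAll N *ᵥ basisState (x' ∘ home)) (z ∘ home) = hGateAll N (z ∘ home) (x' ∘ home) := by
    rw [mulVec_basisState]
  rw [lhs, embedState_apply, if_pos (zeroOn_empty z), Pi.smul_apply, rhs, smul_eq_mul,
    hGateAll_apply_eq_prod, hGateAll_apply_eq_prod, prod_eq_prod_embedding_mul_prod_complWireEmb home]
  have hcompl : ∀ l, x' (complWireEmb home l) = false := fun l => hx _ (complWireEmb_not_mem_range home l)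
  simp only [hcompl, hadamardEntry_false_right, Finset.prod_const, Finset.card_univ, Fintype.card_fin,
    card_compl_map, Function.comp_apply]
  ring

/-! ### Reading out squared amplitudes -/

/-- When the spent wires are exactly the non-logical wires, `ZeroOn S z` says that `z` vanishes off
the logical wires. [folklore] -/
theorem zeroOn_iff_forall_not_mem_range {pos : Fin N ↪ Fin W} {S : Finset (Fin W)}
    (hS : ∀ w, w ∉ Set.range pos → w ∈ S) (hS' : ∀ j, pos j ∉ S) (z : QReg W) :
    ZeroOn S z ↔ ∀ i, i ∉ Set.range pos → z i = (fun _ => false : QReg W) i := by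
  constructor
  · intro h i hi; exact h i (hS i hi)
  · intro h w hw; exact h w (by rintro ⟨j, rfl⟩; exact hS' j hw)

/-- **Read-out.** If the spent wires `S` are all the non-logical wires, the squared amplitudes of
an embedded state over an event "`S` reads `0…0` and the logical register satisfies `P`" add up
to the squared amplitudes of the logical state over `P`. (Born rule on the big register versus
the logical register.) [cite: NielsenChuang2010, §2.2.5] -/
theorem sum_ite_normSq_embedState (pos : Fin N ↪ Fin W) {S : Finset (Fin W)}
    (hS : ∀ w, w ∉ Set.range pos → w ∈ S) (hS' : ∀ j, pos j ∉ S)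
    (P : QReg N → Prop) [DecidablePred P] (φ : QReg N → ℂ) :
    (∑ z : QReg W, if ZeroOn S z ∧ P (z ∘ pos) then ‖embedState pos S φ z‖ ^ 2 else 0) =
      ∑ y : QReg N, if P y then ‖φ y‖ ^ 2 else 0 := by
  have h : ∀ z : QReg W, (if ZeroOn S z ∧ P (z ∘ pos) then ‖embedState pos S φ z‖ ^ 2 else 0) =
      if (∀ i, i ∉ Set.range pos → z i = (fun _ => false : QReg W) i) then
        (if P (z ∘ pos) then ‖φ (z ∘ pos)‖ ^ 2 else 0) else 0 := by
    intro z
    by_cases hz : ZeroOn S z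
    · have hz' : ∀ i, i ∉ Set.range pos → z i = (fun _ => false : QReg W) i :=
        (zeroOn_iff_forall_not_mem_range hS hS' z).1 hz
      simp only [hz, true_and, embedState_apply, if_true, if_pos hz']
    · have hz' : ¬ ∀ i, i ∉ Set.range pos → z i = (fun _ => false : QReg W) i := fun h =>
        hz ((zeroOn_iff_forall_not_mem_range hS hS' z).2 h)
      rw [if_neg (fun h => hz h.1), if_neg hz']
  simp_rw [h]
  rw [sum_ite_agree_eq_sum_extend]
  simp only [extend_comp_embedding]

end HGadget

end Literature.Computability.QuantumComplexity
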